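import Summits.QuantumFields.YangMills.Theorems.AllWindowsColdBoxBoxHighLineStep2Defs
import Summits.QuantumFields.YangMills.Theorems.AllWindowsColdBoxBoxHighLineSmearedFPWeight
import Summits.QuantumFields.YangMills.Theorems.AllWindowsColdBoxBoxHighLineLandauBallQuaternion
import Summits.QuantumFields.YangMills.Theorems.AllWindowsColdBoxBoxHighLinePauliChartComparison

/-!
# T-S5.6 input: support localisation of the Faddeev–Popov chart weight — `χ_r(edgeChart a) ≠ 0 ⇒ a ∈ smallField H (π·r)` on the chart domain
# (STUB-PLAN-S5-STEP2 §5 T-S5.6 `SmallFieldInsideFP`; LINE-19 S5 ⟨stmt-QuantumFields-24004⟩/⟨24335⟩, LINE-20 U5 ⟨24336⟩; objects from ✓`…Step2Defs` BY NAME)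

Width seat `ym-line-sfw-p2-w4` (prover-ym-line-sfw-p2-w4-g27-0).  In T-S5.6 the integrand `fpChartWeight β H r a` carries the cut-off `ballCutoff H r (edgeChart H a)`;
where it is non-zero every box link of the edge chart lies in the `2r`-ball (✓`linkDefect_lt_of_ballCutoff_ne_zero`), and on the chart domain `‖a_e‖ < π` the
quaternion chart comparison ✓4j `pauliChartComparison` (`(2/π)‖A‖ ≤ ‖q(e^{iA}) − 1‖`) with ✓`LandauBall.linkDefect_eq_norm_sq` turns this into `‖a_e‖ < π·r`:
* `freeVec_apply_free` / `edgeChart_apply_free` — on a free (box) edge the chart field / chart configuration is `a e` / `expPauli (a e)`;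
* **`norm_lt_of_ballCutoff_edgeChart_ne_zero`** — `a ∈ chartDomain H`, `ballCutoff H r (edgeChart H a) ≠ 0`, `0 ≤ r` ⇒ `∀ e, ‖a e‖ < π·r`;
* **`mem_smallField_of_ballCutoff_edgeChart_ne_zero`** — hence `a ∈ smallField H (π·r)`; contrapositive **`ballCutoff_edgeChart_eq_zero_of_not_smallField`**
  and **`fpChartWeight_eq_zero_of_not_smallField`** — OFF `smallField H (π·r)` (inside the chart domain) the T-S5.6 integrand vanishes, so the OUTER integral of
  T-S5.6 lives on `smallField H (πr) ∖ smallField H s`.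

Everything proved; no definitions; standard axioms.  HONEST LABEL: an S-sized input of the OPEN task T-S5.6 of STEP 2 of the XL stub S5 of a critic-PASSed DRAFT
line on the R2ξ″ cruxes; T-S5.6, S5, U5 and the items ⟨24004⟩ ⟨24335⟩ ⟨24336⟩ remain OPEN; no stub is closed by name, no crux, rung or summit is proved; the
Yang–Mills mass gap is NOT proved by this file.
-/

set_option autoImplicit false

open Real Finset
open Literature.MathematicalPhysics.QuantumFieldTheory.AxialGauge (boxEdges)
open Literature.MathematicalPhysics.QuantumFieldTheory.Balaban1983to89.B10Eq18SigmaSU2Haar (expPauli)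
open Literature.MathematicalPhysics.QuantumLattice (su2Quat)

namespace Summit.QuantumFields.YangMills.Theorems.AllWindowsColdBoxBoxHighLine

namespace EdgeChart

variable {H : ℕ}

/-- A free edge of the cold box is a box edge. -/
theorem mem_boxEdges_of_free (e : LandauFree H) : (e.1.1 : Literature.MathematicalPhysics.QuantumLattice.ZdEdge 4) ∈ boxEdges 4 (2 * H + 1) := by
  have h := e.2
  simp only [landauPin] at h
  exact not_not.1 h

/-- **On a free edge the chart field is `a e`.** -/
theorem freeVec_apply_free (a : LandauFree H → E3) (e : LandauFree H) : freeVec H a e.1.1 = a e := by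
  unfold freeVec
  rw [dif_pos e.1.2, dif_pos (mem_boxEdges_of_free e)]

/-- **On a free edge the chart configuration is `expPauli (a e)`.** -/
theorem edgeChart_apply_free (a : LandauFree H → E3) (e : LandauFree H) : edgeChart H a e.1.1 = expPauli (a e) := by
  rw [edgeChart, freeVec_apply_free]

/-- **Support localisation**: on the chart domain, `χ_r(edgeChart a) ≠ 0` forces `‖a e‖ < π·r` for every free edge. -/
theorem norm_lt_of_ballCutoff_edgeChart_ne_zero {r : ℝ} (hr : 0 ≤ r) {a : LandauFree H → E3} (ha : a ∈ chartDomain H)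
    (hχ : ballCutoff H r (edgeChart H a) ≠ 0) (e : LandauFree H) : ‖a e‖ < Real.pi * r := by
  have hπ : ‖a e‖ ≤ Real.pi := (ha e).le
  have hcmp := (pauliChartComparison (a e) hπ).1
  have hdef := linkDefect_lt_of_ballCutoff_ne_zero hχ (mem_boxEdges_of_free e)
  rw [LandauBall.linkDefect_eq_norm_sq, edgeChart_apply_free] at hdef
  -- `‖q − 1‖² < (2r)²` ⇒ `‖q − 1‖ < 2r`
  have hq : ‖su2Quat (expPauli (a e)) - 1‖ < 2 * r := by
    have h2r : 0 ≤ 2 * r := by linarith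
    nlinarith [norm_nonneg (su2Quat (expPauli (a e)) - 1)]
  have hpi : 0 < Real.pi := Real.pi_pos
  -- `(2/π)‖a e‖ ≤ ‖q − 1‖ < 2r`
  have h : 2 / Real.pi * ‖a e‖ < 2 * r := lt_of_le_of_lt hcmp hq
  rw [div_mul_eq_mul_div, div_lt_iff₀ hpi] at h
  nlinarith

/-- … so `a ∈ smallField H (π·r)`. -/
theorem mem_smallField_of_ballCutoff_edgeChart_ne_zero {r : ℝ} (hr : 0 ≤ r) {a : LandauFree H → E3} (ha : a ∈ chartDomain H)
    (hχ : ballCutoff H r (edgeChart H a) ≠ 0) : a ∈ smallField H (Real.pi * r) :=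
  fun e => (norm_lt_of_ballCutoff_edgeChart_ne_zero hr ha hχ e).le

/-- Contrapositive: off `smallField H (π·r)` (inside the chart domain) the cut-off vanishes. -/
theorem ballCutoff_edgeChart_eq_zero_of_not_smallField {r : ℝ} (hr : 0 ≤ r) {a : LandauFree H → E3} (ha : a ∈ chartDomain H)
    (hna : a ∉ smallField H (Real.pi * r)) : ballCutoff H r (edgeChart H a) = 0 := by
  by_contra h
  exact hna (mem_smallField_of_ballCutoff_edgeChart_ne_zero hr ha h)

/-- **The T-S5.6 integrand vanishes off `smallField H (π·r)`** (inside the chart domain). -/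
theorem fpChartWeight_eq_zero_of_not_smallField (β : ℝ) {r : ℝ} (hr : 0 ≤ r) {a : LandauFree H → E3} (ha : a ∈ chartDomain H)
    (hna : a ∉ smallField H (Real.pi * r)) : fpChartWeight β H r a = 0 := by
  rw [fpChartWeight, ballCutoff_edgeChart_eq_zero_of_not_smallField hr ha hna]
  simp

end EdgeChart

end Summit.QuantumFields.YangMills.Theorems.AllWindowsColdBoxBoxHighLine
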